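import Literature.Probability.RandomPlanarGeometry.SLETraceStrongMarkov
import Literature.Probability.RandomPlanarGeometry.BrownianOptionalMarkov
import HarnessLib

/-!
# The conformal Markov property of the SLE trace at optional times

Topic `Probability/RandomPlanarGeometry`; theorems only. `SLETraceStrongMarkov.lean` proves the
conformal Markov property of the chordal SLE_κ trace `γ = sleTrace κ ω` at stopping times of the
RAW Brownian filtration `𝓕ᵂ`. The times at which it is USED — "apply the Markov property at the
first hitting time of `B(z, ε)`" (Beffara (2008), §3), the first hitting time of a closed set by
the trace (Rohde–Schramm (2005), §7 p. 911; Lawler (2005), §6.2–6.3; the domain Markov property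
of chordal SLE in a domain) — are hitting times of closed sets BY THE TRACE, which are not raw
stopping times (the trace is only an almost everywhere defined functional of the Brownian path)
but are almost surely equal to **optional times**, i.e. stopping times of the right-continuous
regularisation `𝓕ᵂ₊` (`SLETraceHittingMarkov.lean`). This file records that everything in
`SLETraceStrongMarkov.lean` holds verbatim at `𝓕ᵂ₊`-stopping times `τ`, with events and frozen
data in `𝓕ᵂ_{τ+}` (Mathlib's `IsStoppingTime.measurableSpace` for the filtration
`brownianFiltration.rightCont`), from the strong Markov property of `B` at optional times
(`BrownianOptionalMarkov.lean`; Le Gall (2016), Thm. 2.20 with `(𝓕ₜ₊)`):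

* `ae_exists_isGeneratedByCurve_incrAfter_rightCont` — a.s. on `{τ < ∞}` the chain of
  `√κ Z^τ`, `Z^τ = B_{τ+·} - B_τ`, is generated by a curve;
* `ae_sleTrace_add_eq_extendFrom_rightCont` — a.s. `γ(τ + u) = F_τ(γ^τ(u) + W(τ))` for all `u`;
* `setIntegral_sleTraceAfter_eq_setIntegral_integral_rightCont` — the freezing formula
  `E[F(X, γ^τ); A, τ < ∞] = E[E_{ω'}[F(X(ω), γ(ω'))]; A, τ < ∞]`;
* `measurable_stoppedPast_rightCont`, `measurable_stoppedPastC_rightCont` — the frozen past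
  `(W(· ∧ τ), τ)`, as a raw path or as an element of `C(ℝ≥0, ℝ)` (Borel σ-algebra, scoped
  instances `PathBorel`), is `𝓕ᵂ_{τ+}`-measurable;
* `sleTraceAfter_congr` — `γ^τ(ω)` depends on `τ` only through `τ ω` (so a.s. equal random
  times give the same objects).

## References

* S. Rohde, O. Schramm, *Basic properties of SLE*, Ann. of Math. 161 (2005), Prop. 2.1, §7
  p. 911.
* G. F. Lawler, *Conformally Invariant Processes in the Plane*, AMS (2005), §6.2–6.3.
* V. Beffara, *The dimension of the SLE curves*, Ann. Probab. 36 (2008), §3.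
* J.-F. Le Gall, *Brownian Motion, Martingales, and Stochastic Calculus* (2016), Thm. 2.20,
  Thm. 3.7.
-/

noncomputable section

open Set Filter Topology MeasureTheory ProbabilityTheory Complex
open UpperHalfPlane (upperHalfPlaneSet isOpen_upperHalfPlaneSet)
open scoped NNReal

namespace Literature.Probability.RandomPlanarGeometry

open Literature.Probability.Process
open scoped PathBorel

variable {κ : ℝ≥0} {τ σ : (ℝ≥0 → ℝ) → WithTop ℝ≥0}

/-! ### Dependence on the value of the random time only -/

/-- `Z^τ(ω)` depends on `τ` only through `τ ω`. [folklore] -/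
theorem brownianIncrAfter_congr {ω : ℝ≥0 → ℝ} (h : τ ω = σ ω) (u : ℝ≥0) :
    brownianIncrAfter τ u ω = brownianIncrAfter σ u ω := by
  rw [brownianIncrAfter_apply, brownianIncrAfter_apply, h]

/-- `√κ Z^τ(ω)` depends on `τ` only through `τ ω`. [folklore] -/
theorem sleDrivingAfter_congr {ω : ℝ≥0 → ℝ} (h : τ ω = σ ω) :
    sleDrivingAfter κ τ ω = sleDrivingAfter κ σ ω := by
  funext u
  rw [sleDrivingAfter, sleDrivingAfter, brownianIncrAfter_congr h]

/-- `γ^τ(ω)` depends on `τ` only through `τ ω`. [folklore] -/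
theorem sleTraceAfter_congr {ω : ℝ≥0 → ℝ} (h : τ ω = σ ω) :
    sleTraceAfter κ τ ω = sleTraceAfter κ σ ω := by
  rw [sleTraceAfter, sleTraceAfter, sleDrivingAfter_congr h]

/-! ### The trace after an optional time -/

/-- The generation event after a measurable random time is measurable. [folklore] -/
theorem measurableSet_generatedAfter_of_measurable (hτ : Measurable τ) :
    MeasurableSet {ω | ∃ γ, Loewner.IsGeneratedByCurve (sleDrivingAfter κ τ ω) γ} := by
  obtain ⟨S, hS, hSiff⟩ := exists_measurableSet_generated κ
  have hZ : {ω | ∃ γ, Loewner.IsGeneratedByCurve (sleDrivingAfter κ τ ω) γ} =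
      (fun ω u ↦ brownianIncrAfter τ u ω) ⁻¹' S := by
    ext ω
    rw [mem_preimage, hSiff _ (continuous_brownianIncrAfter τ ω)]
    rfl
  rw [hZ]
  exact measurable_brownianIncrAfter_pi hτ hS

/-- **The generation event after an optional time `τ`, on `A ∩ {τ < ∞}`, has the probability of
`A ∩ {τ < ∞}`** (`HasSLETrace κ`, `A ∈ 𝓕ᵂ_{τ+}`): `{√κ Z^τ generated} = (Z^τ)⁻¹ S` with
`P[B ∈ S] = 1`, and `P[Z^τ ∈ S, A, τ < ∞] = P[B ∈ S] P[A, τ < ∞]`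
(`measure_brownianIncrAfter_mem_inter_rightCont`). [folklore] -/
theorem measure_generatedAfter_inter_rightCont (h0 : HasSLETrace κ)
    (hτ : IsStoppingTime brownianFiltration.rightCont τ)
    {A : Set (ℝ≥0 → ℝ)} (hA : MeasurableSet[hτ.measurableSpace] A) :
    Process.preWienerMeasure ({ω | ∃ γ, Loewner.IsGeneratedByCurve (sleDrivingAfter κ τ ω) γ} ∩
        (A ∩ {ω | τ ω ≠ ⊤})) = Process.preWienerMeasure (A ∩ {ω | τ ω ≠ ⊤}) := by
  haveI := isProbabilityMeasure_preWienerMeasure'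
  obtain ⟨S, hS, hSiff⟩ := exists_measurableSet_generated κ
  have hB : Process.preWienerMeasure ((fun ω u ↦ Process.brownian u ω) ⁻¹' S) = 1 := by
    have h1 : {ω | ∃ γ, Loewner.IsGeneratedByCurve (sleDriving κ ω) γ} =
        (fun ω u ↦ Process.brownian u ω) ⁻¹' S := by
      ext ω
      rw [mem_preimage, hSiff _ (Process.continuous_brownian ω)]
      rfl
    have h2 : ∀ᵐ ω ∂Process.preWienerMeasure,
        ω ∈ {ω | ∃ γ, Loewner.IsGeneratedByCurve (sleDriving κ ω) γ} := h0
    rw [h1] at h2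
    exact (mem_ae_iff_prob_eq_one (measurable_brownian_pi hS)).1 h2
  have hZ : {ω | ∃ γ, Loewner.IsGeneratedByCurve (sleDrivingAfter κ τ ω) γ} =
      (fun ω u ↦ brownianIncrAfter τ u ω) ⁻¹' S := by
    ext ω
    rw [mem_preimage, hSiff _ (continuous_brownianIncrAfter τ ω)]
    rfl
  rw [hZ, measure_brownianIncrAfter_mem_inter_rightCont hτ hA hS, hB, one_mul]

/-- **Almost surely on `{τ < ∞}`, the chain of `√κ Z^τ` is generated by a curve**, for any
optional time `τ` (`HasSLETrace κ`): Rohde–Schramm's Thm. 5.1 transported to the Brownian motion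
`Z^τ` by the strong Markov property at optional times. [cite: RohdeSchramm2005, Thm 5.1] -/
theorem ae_exists_isGeneratedByCurve_incrAfter_rightCont (h0 : HasSLETrace κ)
    (hτ : IsStoppingTime brownianFiltration.rightCont τ) :
    ∀ᵐ ω ∂Process.preWienerMeasure, τ ω ≠ ⊤ →
      ∃ γ, Loewner.IsGeneratedByCurve (sleDrivingAfter κ τ ω) γ := by
  haveI := isProbabilityMeasure_preWienerMeasure'
  set G := {ω : ℝ≥0 → ℝ | ∃ γ, Loewner.IsGeneratedByCurve (sleDrivingAfter κ τ ω) γ} with hG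
  set N := {ω : ℝ≥0 → ℝ | τ ω ≠ ⊤} with hN
  have hGm : MeasurableSet G := measurableSet_generatedAfter_of_measurable hτ.measurable'
  have h1 := measure_generatedAfter_inter_rightCont (κ := κ) h0 hτ
    (@MeasurableSet.univ _ hτ.measurableSpace)
  rw [Set.univ_inter] at h1
  have hnull : Process.preWienerMeasure (N \ G) = 0 := by
    have h2 : Process.preWienerMeasure (N \ G) + Process.preWienerMeasure (N ∩ G) =
        Process.preWienerMeasure N := measure_sdiff_add_inter N hGm
    rw [Set.inter_comm, h1] at h2
    have hfin : Process.preWienerMeasure N ≠ ⊤ := measure_ne_top _ _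
    calc Process.preWienerMeasure (N \ G)
        = Process.preWienerMeasure (N \ G) + Process.preWienerMeasure N -
            Process.preWienerMeasure N := (ENNReal.add_sub_cancel_right hfin).symm
      _ = Process.preWienerMeasure N - Process.preWienerMeasure N := by rw [h2]
      _ = 0 := tsub_self _
  rw [ae_iff]
  refine measure_mono_null (fun ω hω ↦ ?_) hnull
  simp only [mem_setOf_eq, Classical.not_imp] at hω
  exact ⟨hω.1, hω.2⟩

/-- **The Markov decomposition of the SLE trace at an optional time.** Under `HasSLETrace κ`,
for a stopping time `τ` of `𝓕ᵂ₊`: a.s., if `τ = r < ∞` then for all `u`,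
`γ(r + u) = F_r(γ^τ(u) + W(r))` (`γ = sleTrace κ ω`, `γ^τ = sleTraceAfter κ τ ω`, `F_r` the
continuous extension of `g_r⁻¹` to the closed half-plane; the deterministic
`Loewner.IsGeneratedByCurve.apply_add_eq_extendFrom`). Lawler (2005), §6.2; Rohde–Schramm (2005),
p. 911. [cite: Lawler2005, §6.2] -/
theorem ae_sleTrace_add_eq_extendFrom_rightCont (h0 : HasSLETrace κ)
    (hτ : IsStoppingTime brownianFiltration.rightCont τ) :
    ∀ᵐ ω ∂Process.preWienerMeasure, ∀ r : ℝ≥0, τ ω = r → ∀ u : ℝ≥0,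
      sleTrace κ ω (r + u) = extendFrom upperHalfPlaneSet (Loewner.loewnerInv (sleDriving κ ω) r)
        (sleTraceAfter κ τ ω u + sleDriving κ ω r) := by
  filter_upwards [h0, ae_exists_isGeneratedByCurve_incrAfter_rightCont h0 hτ] with ω hω hωτ r hr u
  have hgen := hωτ (by rw [hr]; exact WithTop.coe_ne_top)
  have heq : sleDrivingAfter κ τ ω = fun u ↦ sleDriving κ ω (r + u) - sleDriving κ ω r :=
    funext fun u ↦ sleDrivingAfter_of_eq_coe hr u
  have hγs : Loewner.IsGeneratedByCurve (fun u ↦ sleDriving κ ω (r + u) - sleDriving κ ω r)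
      (sleTraceAfter κ τ ω) := by
    rw [sleTraceAfter, heq]
    rw [heq] at hgen
    exact Loewner.isGeneratedByCurve_trace hgen
  exact (Loewner.isGeneratedByCurve_trace hω).apply_add_eq_extendFrom (continuous_sleDriving κ ω)
    hγs u

/-- **The conformal Markov property of the SLE trace at an optional time (freezing form).**
Under `HasSLETrace κ`, for a stopping time `τ` of `𝓕ᵂ₊`, `A ∈ 𝓕ᵂ_{τ+}`, `X`
`𝓕ᵂ_{τ+}`-measurable and `F` bounded and jointly measurable on `𝒳 × (ℝ≥0 → ℂ)`:
`E[F(X, γ^τ); A, τ < ∞] = E[ E_{ω'}[F(X(ω), γ(ω'))] ; A, τ < ∞]` (`γ = sleTrace κ`,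
`γ^τ = sleTraceAfter κ τ`). Rohde–Schramm (2005), §7 p. 911; Lawler (2005), §6.2–6.3; Beffara
(2008), §3. [cite: RohdeSchramm2005, Prop. 2.1] -/
theorem setIntegral_sleTraceAfter_eq_setIntegral_integral_rightCont {𝒳 : Type*}
    [MeasurableSpace 𝒳] (h0 : HasSLETrace κ)
    (hτ : IsStoppingTime brownianFiltration.rightCont τ) {X : (ℝ≥0 → ℝ) → 𝒳}
    (hX : Measurable[hτ.measurableSpace] X) {F : 𝒳 → (ℝ≥0 → ℂ) → ℝ}
    (hFm : Measurable (Function.uncurry F)) {C : ℝ} (hFb : ∀ x γ, |F x γ| ≤ C) {A : Set (ℝ≥0 → ℝ)}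
    (hA : MeasurableSet[hτ.measurableSpace] A) :
    ∫ ω in A ∩ {ω | τ ω ≠ ⊤}, F (X ω) (sleTraceAfter κ τ ω) ∂Process.preWienerMeasure =
      ∫ ω in A ∩ {ω | τ ω ≠ ⊤}, (∫ ω', F (X ω) (sleTrace κ ω') ∂Process.preWienerMeasure)
        ∂Process.preWienerMeasure := by
  haveI := isProbabilityMeasure_preWienerMeasure'
  obtain ⟨T, hTm, hT⟩ := Loewner.exists_measurable_eq_trace
  have hsc : Measurable fun (w : ℝ≥0 → ℝ) (u : ℝ≥0) ↦ Real.sqrt κ * w u :=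
    measurable_pi_lambda _ fun u ↦ (measurable_pi_apply u).const_mul _
  set F' : 𝒳 → (ℝ≥0 → ℝ) → ℝ := fun x w ↦ F x (T fun u ↦ Real.sqrt κ * w u) with hF'
  have hF'm : Measurable (Function.uncurry F') :=
    hFm.comp (measurable_fst.prodMk ((hTm.comp hsc).comp measurable_snd))
  have hF'b : ∀ x w, |F' x w| ≤ C := fun x w ↦ hFb x _
  have h := setIntegral_brownianIncrAfter_eq_setIntegral_integral_rightCont hτ hX hF'm hF'b hA
  have hAm : MeasurableSet (A ∩ {ω | τ ω ≠ ⊤}) := measurableSet_inter_ne_top_rightCont hτ hA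
  have hL : ∀ᵐ ω ∂Process.preWienerMeasure, ω ∈ A ∩ {ω | τ ω ≠ ⊤} →
      F' (X ω) (fun u ↦ brownianIncrAfter τ u ω) = F (X ω) (sleTraceAfter κ τ ω) := by
    filter_upwards [ae_exists_isGeneratedByCurve_incrAfter_rightCont h0 hτ] with ω hω hωA
    have hgen := hω hωA.2
    simp only [hF', sleTraceAfter]
    rw [show (fun u ↦ Real.sqrt κ * brownianIncrAfter τ u ω) = sleDrivingAfter κ τ ω from rfl,
      hT _ (continuous_sleDrivingAfter ω) hgen]
  have hR : ∀ x : 𝒳, ∫ ω', F' x (fun u ↦ Process.brownian u ω') ∂Process.preWienerMeasure =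
      ∫ ω', F x (sleTrace κ ω') ∂Process.preWienerMeasure := by
    intro x
    refine integral_congr_ae ?_
    filter_upwards [h0] with ω' hω'
    simp only [hF']
    rw [show (fun u ↦ Real.sqrt κ * Process.brownian u ω') = sleDriving κ ω' from rfl,
      hT _ (continuous_sleDriving κ ω') hω']
    rfl
  rw [← setIntegral_congr_ae hAm hL, h]
  exact setIntegral_congr_fun hAm fun ω _ ↦ hR (X ω)

/-! ### The frozen past `(W(· ∧ τ), τ)` is `𝓕ᵂ_{τ+}`-measurable -/

/-- `Measurable` for a pi-valued map, with the σ-algebra on the domain given as a term (a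
restatement of Mathlib's `measurable_pi_lambda` usable for sub-σ-algebras). [folklore] -/
theorem measurable_pi_lambda_of {α δ : Type*} {π : δ → Type*} {mα : MeasurableSpace α}
    [∀ a, MeasurableSpace (π a)] (f : α → ∀ a, π a) (hf : ∀ a, Measurable[mα] fun c ↦ f c a) :
    Measurable[mα] f :=
  measurable_pi_lambda f hf

variable (κ) in
/-- **The frozen past is `𝓕ᵂ_{τ+}`-measurable.** For a stopping time `τ` of `𝓕ᵂ₊`, the pair
`(u ↦ W(u ∧ τ), τ)` — the driving path `W = √κ B` stopped at `τ` (read with `τ ∧ u = u ∧ 0 = 0`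
on `{τ = ∞}`, Mathlib's `WithTop.untopD 0`) and the time `τ` — is measurable with respect to
`𝓕ᵂ_{τ+}`: it is a measurable function of `(B_{· ∧ τ}, τ)`
(`measurable_stoppedProcess_brownian_rightCont`, `IsStoppingTime.measurable`).
[cite: Legall2016, Thm. 3.7] -/
theorem measurable_stoppedPast_rightCont (hτ : IsStoppingTime brownianFiltration.rightCont τ) :
    Measurable[hτ.measurableSpace] fun ω ↦
      ((fun u ↦ sleDriving κ ω (min u ((τ ω).untopD 0))), τ ω) := by
  classical
  -- `Φ (w, c) = (u ↦ if c = ⊤ then 0 else √κ w u, c)` on `(ℝ≥0 → ℝ) × WithTop ℝ≥0`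
  set Φ : (ℝ≥0 → ℝ) × WithTop ℝ≥0 → (ℝ≥0 → ℝ) × WithTop ℝ≥0 :=
    fun p ↦ (fun u ↦ if p.2 = ⊤ then 0 else Real.sqrt κ * p.1 u, p.2) with hΦ
  have hΦm : Measurable Φ := by
    refine Measurable.prodMk (measurable_pi_lambda _ fun u ↦ ?_) measurable_snd
    refine Measurable.ite ?_ measurable_const (((measurable_pi_apply u).comp measurable_fst).const_mul _)
    exact measurable_snd (measurableSet_singleton _)
  have hXm : Measurable[hτ.measurableSpace] fun ω ↦
      ((fun u ↦ stoppedProcess Process.brownian τ u ω), τ ω) :=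
    Measurable.prodMk (measurable_pi_lambda_of _ fun u ↦
      measurable_stoppedProcess_brownian_rightCont hτ u) hτ.measurable
  have heq : (fun ω ↦ ((fun u ↦ sleDriving κ ω (min u ((τ ω).untopD 0))), τ ω)) =
      Φ ∘ fun ω ↦ ((fun u ↦ stoppedProcess Process.brownian τ u ω), τ ω) := by
    funext ω
    simp only [hΦ, Function.comp_apply, Prod.mk.injEq, and_true]
    funext u
    induction hω : τ ω using WithTop.recTopCoe with
    | top => simp [sleDriving_apply, Process.brownian_zero]
    | coe r =>
      simp only [WithTop.coe_ne_top, if_false, WithTop.untopD_coe, sleDriving_apply,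
        stoppedProcess, hω, untopA_min_coe_coe]
  rw [heq]
  exact hΦm.comp hXm

/-- `Measurable` into the driving-path space `C(ℝ≥0, ℝ)` (Borel σ-algebra of the compact-open
topology) from measurability of all evaluations, with the σ-algebra on the domain given as a term
(`Process.measurable_continuousMap_of_eval`, usable for sub-σ-algebras). [folklore] -/
theorem measurable_continuousMap_of_eval_of {Ω : Type*} {mΩ : MeasurableSpace Ω}
    {Φ : Ω → C(ℝ≥0, ℝ)} (h : ∀ a, Measurable[mΩ] fun ω ↦ Φ ω a) : Measurable[mΩ] Φ :=
  Process.measurable_continuousMap_of_eval h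

variable (κ) in
/-- **The frozen past, as a continuous path, is `𝓕ᵂ_{τ+}`-measurable**: for a stopping time `τ`
of `𝓕ᵂ₊`, the pair `(W(· ∧ τ), τ)` with the stopped driving path bundled as an element of
`C(ℝ≥0, ℝ)` (Borel σ-algebra of the compact-open topology, scoped instance `PathBorel`) is
measurable with respect to `𝓕ᵂ_{τ+}` (all evaluations are, `measurable_stoppedPast_rightCont`;
`Process.measurable_continuousMap_of_eval`). This is the form in which functionals of the
configuration at time `τ` (e.g. the inverse Loewner map `f_τ`, a continuous functional of the
driving path on compacts and of the time) are measurable functions of the past.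
[cite: Legall2016, Thm. 3.7] -/
theorem measurable_stoppedPastC_rightCont (hτ : IsStoppingTime brownianFiltration.rightCont τ) :
    Measurable[hτ.measurableSpace] fun ω ↦
      ((⟨fun u ↦ sleDriving κ ω (min u ((τ ω).untopD 0)),
        (continuous_sleDriving κ ω).comp (continuous_id.min continuous_const)⟩ : C(ℝ≥0, ℝ)),
        τ ω) := by
  refine Measurable.prodMk (measurable_continuousMap_of_eval_of fun u ↦ ?_) hτ.measurable
  exact (measurable_pi_apply u).comp (measurable_stoppedPast_rightCont κ hτ).fst

end Literature.Probability.RandomPlanarGeometry
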